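import Summits.PneNP.PneNP.Theorems.ReslinSizeFromWidthPCDegreeTranslation
import HarnessLib

/-!
# PneNP / ReslinSizeFromWidth — polynomial calculus over `𝔽₂` simulates Res(⊕): degree ≤ rank + 1

Helper file for the INPUT side of crux `ResLinSizeFromWidth` (stmt-PneNP-18932), second part
(the simulation; the translation `ResLinPC.clausePoly` and its algebra are in
`ReslinSizeFromWidthPCDegreeTranslation.lean`).

**Theorem** (`pc_refutableInDegree_of_isResLinRefutation`).  Let `φ` be a CNF all of whose
clauses have at most `w + 1` literals.  If `φ` has a Res(⊕) refutation `π` (Itsykson–Sokolov,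
SEMANTIC weakening, `IsResLinRefutation`) all of whose lines `C` have rank `rk(¬C) ≤ w`
(`resLinWidth π ≤ w`), then the clause polynomials of `φ` over `𝔽₂` (Krajíček's translation
(6.0.1), `PolyCalc.cnfPolys (ZMod 2) φ`) have a PC/`𝔽₂` refutation of degree at most `w + 1`
(`PC.RefutableInDegree`, Krajíček's PC/F with explicit Boolean axioms and the product rule).
Contrapositive (`le_resLinWidth_of_not_refutableInDegree`, `le_minResLinWidth_of_not_refutableInDegree`):
a degree lower bound `d` for PC/`𝔽₂` refutations of `φ` (clauses of length `≤ d`) forces a line of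
rank `≥ d` in EVERY Res(⊕) refutation of `φ` — the "indirect route" to Res(⊕) width/rank lower
bounds [Efremenko–Garlík–Itsykson 2024, §1.2: "All previously known lower bounds on width/rank were
based on polynomial calculus degree lower bounds"].

The simulation is line by line: every line `C` of `π` yields a degree-`≤ w+1` derivation of its
translation `clausePoly C` (`derivable_clausePoly_of_mem`):
* an initial clause `c` is an axiom `unsatPolyK c` of degree `|c| ≤ w + 1`, reduced to
  `clausePoly c` inside that degree (`MLPC.pc_derivableInDegree_ml`);
* the key step (`derivable_clausePoly_union`): from `clausePoly C` one derives `clausePoly (C ∪ T)`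
  literal by literal, multiplying by the falsity polynomial of a literal ONLY when its hyperplane
  cuts the current falsifying flat properly (then `dim W` rises by one, so the product has degree
  `≤ dim W (¬(C ∪ T))`), doing nothing when the hyperplane contains the flat, and passing to `0`
  when it is disjoint from it;
* a resolution step `C ∨ (f=0), D ∨ (f=1) ⊢ C ∨ D =: E` extends the two premises to
  `clausePoly (E ∨ f=0)` and `clausePoly (E ∨ f=1)` — flats `¬E ∩ {f = 1}`, `¬E ∩ {f = 0}` with
  `dim W ≤ rk(¬E) + 1 ≤ w + 1`, the only place where the `+1` is spent — and adds them
  (`clausePoly_insert_false_add_insert_true`);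
* a semantic weakening `C ⊢ D` (`¬D ⊆ ¬C`) extends `clausePoly C` to `clausePoly (C ∪ D) =
  clausePoly D` inside degree `rk(¬D) ≤ w`.

In print: Garlík–Kołodziejczyk 2018 (proof of Thm 18, "degree-O(h) Polynomial Calculus", "a
tedious but straightforward verification"); Gryaznov–Ovcharov–Riazanov 2024, Thm 7
("Deg(φ) ≤ Width(φ)", no proof); Efremenko–Garlík–Itsykson 2024, §1.1.1 ("degree w + O(1)", width =
number of equations in a clause).  Here: width = RANK (`linClauseRank ≤` number of equations, so
this is the stronger form), constant `+1`, semantic weakening, kernel-checked.  The `+1` is what a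
line-by-line translation costs at a resolution step on a form independent of the conclusion (e.g.
`xy, z(1+x) ⊢ yz` needs degree 3); whether `Deg ≤ Width` holds exactly as stated by GOR is not
decided here.

References: M. Garlík, L. A. Kołodziejczyk, ACM ToCL 19(4) (2018), §8; S. Gryaznov, S. Ovcharov,
A. Riazanov, ACM ToCT (2024), arXiv:2404.08370, Thm 7 and Cor. 1; K. Efremenko, M. Garlík,
D. Itsykson, STOC 2024, §1.1.1–1.2; J. Krajíček, *Proof Complexity* (2019), §6.2.
-/

noncomputable section

namespace Summit.PneNP.PneNP.Theorems

-- `Summit.PneNP.PneNP` repeats a path component by design (summit = sub-problem); silence the linter.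
set_option linter.dupNamespace false

namespace ResLinPC

open MvPolynomial Finset Module
open Literature.Computability.Complexity Literature.Computability.MetaComplexity
open Literature.Computability.MetaComplexity.MLPC
open Literature.Computability.MetaComplexity.AffSys
open Summit.PneNP.PneNP.Theorems.ResLinRank Summit.PneNP.PneNP.Theorems.ResLinSW
open Summit.PneNP.PneNP.Theorems.PolyCalc

variable {𝓕 : Set (MvPolynomial ℕ (ZMod 2))} {d : ℕ}

/-! ### Derived rules of PC/`𝔽₂` on translated clauses -/

/-- `0` is derivable (inside any degree) as soon as anything is. -/
theorem derivable_zero {p : MvPolynomial ℕ (ZMod 2)} (h : PC.DerivableInDegree 𝓕 d p) :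
    PC.DerivableInDegree 𝓕 d 0 := by
  have := PC.DerivableInDegree.mul (0 : MvPolynomial ℕ (ZMod 2)) h
    (by rw [mul_zero, totalDegree_zero]; exact Nat.zero_le _)
  rwa [mul_zero] at this

/-- **Multiplying by a literal**: from `clausePoly C` derive `clausePoly (C ∨ l)`, at the cost of
one degree above `deg (clausePoly C)` (product rule with `litFalsePoly l`, then reduction). -/
theorem derivable_clausePoly_insert {C : LinClause} (l : LinLit)
    (h : PC.DerivableInDegree 𝓕 d (clausePoly C)) (hdeg : (clausePoly C).totalDegree + 1 ≤ d) :
    PC.DerivableInDegree 𝓕 d (clausePoly (insert l C)) := by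
  rw [clausePoly_insert, mul_comm]
  refine pc_derivableInDegree_ml (PC.DerivableInDegree.mul (litFalsePoly l) h ?_)
  calc (clausePoly C * litFalsePoly l).totalDegree
      ≤ (clausePoly C).totalDegree + (litFalsePoly l).totalDegree := totalDegree_mul _ _
    _ ≤ (clausePoly C).totalDegree + 1 := Nat.add_le_add_left (totalDegree_litFalsePoly_le l) _
    _ ≤ d := hdeg

/-- **Extension by a set of literals** (the key step).  On a window `N` containing all forms: if
`clausePoly C` is derivable inside degree `d` and the falsifying flat of `C ∪ T` is empty or has
`dim W ≤ d`, then `clausePoly (C ∪ T)` is derivable inside degree `d`.  Literals are added one at a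
time; a literal whose hyperplane contains the current flat changes nothing, one disjoint from it
yields `0`, and one cutting it properly raises `dim W` by exactly one (`finrank_W_inter_hyp_eq`),
which pays for the multiplication. -/
theorem derivable_clausePoly_union (N : Finset ℕ) (T : Finset LinLit) :
    ∀ C : LinClause, (∀ l ∈ C, l.1 ⊆ N) → (∀ l ∈ T, l.1 ⊆ N) →
      PC.DerivableInDegree 𝓕 d (clausePoly C) →
      ((falsN N (C ∪ T)).Nonempty → finrank (ZMod 2) (W (falsN N (C ∪ T))) ≤ d) →
      PC.DerivableInDegree 𝓕 d (clausePoly (C ∪ T)) := by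
  classical
  induction T using Finset.induction_on with
  | empty =>
    intro C _ _ h _
    rwa [Finset.union_empty]
  | @insert l T hlT ih =>
    intro C hC hT h hd
    have hl : l.1 ⊆ N := hT l (Finset.mem_insert_self _ _)
    have hT' : ∀ l' ∈ T, l'.1 ⊆ N := fun l' hl' => hT l' (Finset.mem_insert_of_mem hl')
    have hCT : ∀ l' ∈ C ∪ T, l'.1 ⊆ N := by
      intro l' hl'
      rcases Finset.mem_union.1 hl' with h' | h'
      exacts [hC l' h', hT' l' h']
    have hCT' : ∀ l' ∈ insert l (C ∪ T), l'.1 ⊆ N := by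
      intro l' hl'
      rcases Finset.mem_insert.1 hl' with rfl | h'
      exacts [hl, hCT l' h']
    rw [Finset.union_insert] at hd ⊢
    by_cases hempty : falsN N (insert l (C ∪ T)) = ∅
    · rw [clausePoly_eq_zero_of_falsN_eq_empty N hCT' hempty]
      exact derivable_zero h
    · have hne : (falsN N (insert l (C ∪ T))).Nonempty := Set.nonempty_iff_ne_empty.2 hempty
      have hd' := hd hne
      have hsub : falsN N (insert l (C ∪ T)) ⊆ falsN N (C ∪ T) := by
        rw [falsN_insert]
        exact Set.inter_subset_right
      have hneCT : (falsN N (C ∪ T)).Nonempty := hne.mono hsub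
      have ihC := ih C hC hT' h fun _ => (finrank_W_mono N hsub).trans hd'
      by_cases hW : eqOf N l ∈ W (falsN N (C ∪ T))
      · rw [clausePoly_insert_of_subset_hyp N hCT hl (mem_W_iff_subset_hyp.1 hW)]
        exact ihC
      · have hsec : (falsN N (C ∪ T) ∩ hyp (eqOf N l)).Nonempty := by
          rwa [Set.inter_comm, ← falsN_insert]
        have hrk := finrank_W_inter_hyp_eq (isFlat_falsN N (C ∪ T)) (eqOf N l) hsec hW
        refine derivable_clausePoly_insert l ihC ?_
        have h1 := totalDegree_clausePoly_le_finrank N hCT hneCT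
        have h2 : finrank (ZMod 2) (W (falsN N (C ∪ T))) + 1 ≤ d := by
          rw [← hrk, Set.inter_comm, ← falsN_insert]
          exact hd'
        omega

/-- **Initial clauses**: the translation of a clause of `φ` with at most `d` literals is derivable
inside degree `d` from the clause polynomials of `φ`. -/
theorem derivable_clausePoly_initial {φ : CNF ℕ} {c : Clause ℕ} (hc : c ∈ φ)
    (hlen : c.length ≤ d) :
    PC.DerivableInDegree (cnfPolys (ZMod 2) φ) d (clausePoly (Clause.toLinClause c)) := by
  rw [← ml_unsatPolyK]
  exact pc_derivableInDegree_ml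
    (.hyp (mem_cnfPolys.2 ⟨c, hc, rfl⟩) (by rw [totalDegree_unsatPolyK]; exact hlen))

/-- `dim W` of the falsifying flat of `C ∨ l` exceeds `rk(¬C)` by at most one. -/
theorem finrank_W_falsN_insert_le (N : Finset ℕ) (l : LinLit) (E : LinClause)
    (hne : (falsN N (insert l E)).Nonempty) :
    finrank (ZMod 2) (W (falsN N (insert l E))) ≤ linClauseRank E + 1 := by
  have hsec : (falsN N E ∩ hyp (eqOf N l)).Nonempty := by
    rwa [Set.inter_comm, ← falsN_insert]
  have hneE : (falsN N E).Nonempty := hsec.mono Set.inter_subset_left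
  rw [falsN_insert, Set.inter_comm]
  exact (finrank_W_inter_hyp_le (isFlat_falsN N E) (eqOf N l) hsec).trans
    (Nat.add_le_add_right (finrank_W_falsN_le_rank N hneE) 1)

/-- **The resolution rule**: from (the translations of) `C ∨ (f = 0)` and `D ∨ (f = 1)` derive
`C ∨ D`, inside degree `rk(¬(C ∨ D)) + 1`. -/
theorem derivable_clausePoly_resolve (N : Finset ℕ) {C D E : LinClause} {f : Finset ℕ}
    (hE : E = C ∪ D) (hN : ∀ l ∈ E, l.1 ⊆ N) (hf : f ⊆ N)
    (h1 : PC.DerivableInDegree 𝓕 d (clausePoly (insert (f, false) C)))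
    (h2 : PC.DerivableInDegree 𝓕 d (clausePoly (insert (f, true) D)))
    (hd : linClauseRank E + 1 ≤ d) : PC.DerivableInDegree 𝓕 d (clausePoly E) := by
  have hCN : ∀ l ∈ C, l.1 ⊆ N := fun l hl => hN l (by rw [hE]; exact Finset.mem_union_left _ hl)
  have hDN : ∀ l ∈ D, l.1 ⊆ N := fun l hl => hN l (by rw [hE]; exact Finset.mem_union_right _ hl)
  have hC1 : ∀ l ∈ insert (f, false) C, l.1 ⊆ N := by
    intro l hl
    rcases Finset.mem_insert.1 hl with rfl | hl
    exacts [hf, hCN l hl]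
  have hD1 : ∀ l ∈ insert (f, true) D, l.1 ⊆ N := by
    intro l hl
    rcases Finset.mem_insert.1 hl with rfl | hl
    exacts [hf, hDN l hl]
  -- extend the first premise by `D`, the second by `C`
  have e1 : insert (f, false) C ∪ D = insert (f, false) E := by rw [hE, Finset.insert_union]
  have e2 : insert (f, true) D ∪ C = insert (f, true) E := by
    rw [hE, Finset.insert_union, Finset.union_comm]
  have g1 := derivable_clausePoly_union N D (insert (f, false) C) hC1 hDN h1 (by
    rw [e1]; exact fun hne => (finrank_W_falsN_insert_le N _ E hne).trans hd)
  have g2 := derivable_clausePoly_union N C (insert (f, true) D) hD1 hCN h2 (by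
    rw [e2]; exact fun hne => (finrank_W_falsN_insert_le N _ E hne).trans hd)
  rw [e1] at g1
  rw [e2] at g2
  have := PC.DerivableInDegree.add g1 g2
  rwa [clausePoly_insert_false_add_insert_true] at this

/-- **Semantic weakening**: from (the translation of) `C` derive any `D` with `C ⊨ D`, inside
degree `max (current, rk(¬D))`. -/
theorem derivable_clausePoly_weaken (N : Finset ℕ) {C D : LinClause} (hC : ∀ l ∈ C, l.1 ⊆ N)
    (hD : ∀ l ∈ D, l.1 ⊆ N) (himp : ∀ σ : ℕ → Bool, C.eval σ = true → D.eval σ = true)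
    (h : PC.DerivableInDegree 𝓕 d (clausePoly C)) (hd : linClauseRank D ≤ d) :
    PC.DerivableInDegree 𝓕 d (clausePoly D) := by
  rw [← clausePoly_union_of_imp himp]
  refine derivable_clausePoly_union N D C hC hD h fun hne => ?_
  have hset : falsN N (C ∪ D) = falsN N D := by
    rw [falsN_union]
    exact Set.inter_eq_right.2 (falsN_subset_of_imp N hC hD himp)
  rw [hset] at hne ⊢
  exact (finrank_W_falsN_le_rank N hne).trans hd

/-! ### The simulation -/

/-- **Every line of a rank-`≤ w` Res(⊕) derivation translates to a polynomial derivable in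
PC/`𝔽₂` inside degree `w + 1`** (from the clause polynomials of `φ`, whose clauses have at most
`w + 1` literals). -/
theorem derivable_clausePoly_of_mem {φ : CNF ℕ} {w : ℕ} (hφ : ∀ c ∈ φ, c.length ≤ w + 1) :
    ∀ π : List ResLinLine, IsResLinDerivation φ π → (∀ l ∈ π, linClauseRank l.clause ≤ w) →
      ∀ l ∈ π, PC.DerivableInDegree (cnfPolys (ZMod 2) φ) (w + 1) (clausePoly l.clause) := by
  intro π
  induction π using List.reverseRecOn with
  | nil => intro _ _ l hl; simp at hl
  | append_singleton π m ih =>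
    intro hπ hw l hl
    obtain ⟨hπ', hm⟩ := isResLinDerivation_of_append_step hπ
    have hw' : ∀ l' ∈ π, linClauseRank l'.clause ≤ w :=
      fun l' hl' => hw l' (List.mem_append_left _ hl')
    rcases List.mem_append.1 hl with hl | hl
    · exact ih hπ' hw' l hl
    rw [List.mem_singleton] at hl
    subst hl
    -- the window: all variables of the derivation and of `φ`
    set N : Finset ℕ := piVars (π ++ [l]) ∪ cnfVars φ with hN
    have hforms : ∀ l' ∈ π ++ [l], ∀ lit ∈ l'.clause, lit.1 ⊆ N :=
      fun l' hl' lit hlit => (subset_piVars hl' hlit).trans Finset.subset_union_left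
    have hlmem : l ∈ π ++ [l] := List.mem_append_right _ (List.mem_singleton_self _)
    have hrank : linClauseRank l.clause ≤ w := hw l hlmem
    have hv := hm
    unfold IsValidResLinLine at hv
    rcases hr : l.rule with _ | ⟨i, j, f⟩ | i <;> simp only [hr] at hv
    · -- initial clause
      obtain ⟨c, hc, hcl⟩ := hv
      rw [hcl]
      exact derivable_clausePoly_initial hc (hφ c hc)
    · -- resolution step
      obtain ⟨hi, hj, C, D, hC, hD, hcl⟩ := hv
      have h1 := ih hπ' hw' _ (List.getElem_mem hi)
      have h2 := ih hπ' hw' _ (List.getElem_mem hj)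
      rw [hC] at h1
      rw [hD] at h2
      have hf : f ⊆ N := by
        have := hforms (π[i]'hi) (List.mem_append_left _ (List.getElem_mem hi)) (f, false)
          (by rw [hC]; exact Finset.mem_insert_self _ _)
        exact this
      exact derivable_clausePoly_resolve N hcl (hforms l hlmem) hf h1 h2
        (Nat.add_le_add_right hrank 1)
    · -- semantic weakening
      obtain ⟨hi, himp⟩ := hv
      exact derivable_clausePoly_weaken N
        (hforms (π[i]'hi) (List.mem_append_left _ (List.getElem_mem hi))) (hforms l hlmem) himp
        (ih hπ' hw' _ (List.getElem_mem hi)) (hrank.trans (Nat.le_succ w))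

/-- **PC over `𝔽₂` simulates Res(⊕) with degree ≤ rank + 1.**  If a CNF `φ` with clauses of at
most `w + 1` literals has a Res(⊕) refutation of rank-width `≤ w`, then its clause polynomials have
a PC/`𝔽₂` refutation of degree `≤ w + 1`. [Garlík–Kołodziejczyk 2018, proof of Thm 18;
Gryaznov–Ovcharov–Riazanov 2024, Thm 7; Efremenko–Garlík–Itsykson 2024, §1.1.1] -/
theorem pc_refutableInDegree_of_isResLinRefutation {φ : CNF ℕ} {π : List ResLinLine} {w : ℕ}
    (hπ : IsResLinRefutation φ π) (hw : resLinWidth π ≤ w) (hφ : ∀ c ∈ φ, c.length ≤ w + 1) :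
    PC.RefutableInDegree (cnfPolys (ZMod 2) φ) (w + 1) := by
  obtain ⟨l, hl, hl0⟩ := hπ.2
  have h := derivable_clausePoly_of_mem hφ π hπ.1
    (fun l' hl' => (linClauseRank_le_resLinWidth hl').trans hw) l hl
  rw [hl0, clausePoly_empty] at h
  exact h

/-- **Degree lower bounds give rank lower bounds.**  If the clause polynomials of `φ` (clauses of
at most `d` literals) have NO PC/`𝔽₂` refutation of degree `≤ d`, then every Res(⊕) refutation of
`φ` contains a line `C` with `rk(¬C) ≥ d`. -/
theorem le_resLinWidth_of_not_refutableInDegree {φ : CNF ℕ} {d : ℕ} (hφ : ∀ c ∈ φ, c.length ≤ d)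
    (hdeg : ¬ PC.RefutableInDegree (cnfPolys (ZMod 2) φ) d) {π : List ResLinLine}
    (hπ : IsResLinRefutation φ π) : d ≤ resLinWidth π := by
  by_contra hlt
  rw [not_le] at hlt
  obtain ⟨w, rfl⟩ : ∃ w, d = w + 1 := ⟨d - 1, by omega⟩
  exact hdeg (pc_refutableInDegree_of_isResLinRefutation hπ (by omega) hφ)

/-- The same in terms of the minimal refutation width: `Deg_{PC/𝔽₂}(φ) > d ⇒ minResLinWidth φ ≥ d`
(more precisely: no degree-`≤ d` refutation ⇒ every Res(⊕) refutation has rank-width `≥ d`). -/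
theorem le_minResLinWidth_of_not_refutableInDegree {φ : CNF ℕ} {d : ℕ}
    (hφ : ∀ c ∈ φ, c.length ≤ d) (hdeg : ¬ PC.RefutableInDegree (cnfPolys (ZMod 2) φ) d) :
    (d : ℕ∞) ≤ minResLinWidth φ :=
  le_minResLinWidth_iff.2 fun _ hπ => le_resLinWidth_of_not_refutableInDegree hφ hdeg hπ

end ResLinPC

open Literature.Computability.Complexity Literature.Computability.MetaComplexity
open Summit.PneNP.PneNP.Theorems.PolyCalc

/-- **PC/`𝔽₂` degree ≤ Res(⊕) rank-width + 1** (headline form).  For a CNF `φ` with clauses of at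
most `w + 1` literals: a Res(⊕) refutation (semantic weakening) all of whose lines have rank `≤ w`
yields a PC/`𝔽₂` refutation of Krajíček's clause polynomials of `φ` of degree `≤ w + 1`.
[Garlík–Kołodziejczyk 2018, proof of Thm 18; Gryaznov–Ovcharov–Riazanov 2024, Thm 7 ("Deg ≤ Width",
no proof); Efremenko–Garlík–Itsykson 2024, §1.1.1 ("degree w + O(1)")] -/
theorem resLin_pcDegree_le_rank_succ {φ : CNF ℕ} {π : List ResLinLine} {w : ℕ}
    (hπ : IsResLinRefutation φ π) (hw : resLinWidth π ≤ w) (hφ : ∀ c ∈ φ, c.length ≤ w + 1) :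
    PC.RefutableInDegree (cnfPolys (ZMod 2) φ) (w + 1) :=
  ResLinPC.pc_refutableInDegree_of_isResLinRefutation hπ hw hφ

/-- **The indirect route to Res(⊕) rank lower bounds** (headline form): a PC/`𝔽₂` degree lower
bound `d` for the clause polynomials of `φ` (clauses of length `≤ d`) forces a line of rank `≥ d`
in every Res(⊕) refutation of `φ`. [Efremenko–Garlík–Itsykson 2024, §1.2; Gryaznov–Ovcharov–Riazanov
2024, Cor. 1 (with Thm 6)] -/
theorem resLin_rank_of_pcDegree {φ : CNF ℕ} {d : ℕ} (hφ : ∀ c ∈ φ, c.length ≤ d)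
    (hdeg : ¬ PC.RefutableInDegree (cnfPolys (ZMod 2) φ) d) {π : List ResLinLine}
    (hπ : IsResLinRefutation φ π) : d ≤ resLinWidth π :=
  ResLinPC.le_resLinWidth_of_not_refutableInDegree hφ hdeg hπ

end Summit.PneNP.PneNP.Theorems
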